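import Literature.NumberTheory.ComplexMultiplication.ParallelShadowsSlots
import Literature.NumberTheory.ComplexMultiplication.CMTypeRankIrreducibleSlot
import HarnessLib

/-!
# CAPACITY of a common quotient: linearly dependent shadows make a family degenerate, so at most `|Z|/2` slots with
# non-zero shadow on a common `G`-set `Z` can form an additive family

COR-CM (cell `pub-hodgecm2`, binder seat `b16` gen 49, count-neutral claim PARSHADOW, file F5 — abstract `G`-set level,
sequel of `ParallelShadowsSlots` (F1); theorems only, no definition, no named fact, no `sorry`).  NEW as stated, hence
under `Summits/`.  HONEST FRAMING: a lemma about the Kubota–Dodson rank of families of CM types; `HC_CM` is neither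
used nor asserted.

F1 proves: TWO slots whose shadows `c_i(z) = Σ_{π_i x = z} u_1(Φ_i)(x)` on a common equivariant quotient `Z` are
proportional and non-zero are never additive.  The same linear form handles ANY linear relation:

> **Theorem** (`Shadow.finrank_antiSpan_sigmaType_lt_of_dependent`).  Let `π_i : E_i → Z` be equivariant maps to one
> `G`-set (`i` in a finite set `S` of slots) and suppose the shadows satisfy a linear relation `Σ_{i∈S} λ_i c_i = 0`
> which is non-trivial on the shadows (`λ_{i₀} c_{i₀}(z₀) ≠ 0` for some `i₀ ∈ S`, `z₀`).  Then
> `dim U(Σ) < Σ_i dim U(Φ_i)`: the rank of the family is not additive and `Σ` is degenerate.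

Since every shadow is `ρ`-odd (`c_i(ρz) = −c_i(z)`, `Shadow.fibreSum_antiVec_one_rho_smul`) and the odd functions on
`Z` have dimension `≤ |Z|/2` (`Shadow.finrank_antiWeights_le`), more than `|Z|/2` slots with NON-ZERO shadows are always
dependent:

> **Capacity** (`Shadow.typeRank_sigmaType_add_card_lt_of_card_lt`, `…_lt_of_card_lt`).  If `Z` carries a CM structure
> for `ρ` (a type `S₁ ⊆ Z` with `IsCMTypeWith ρ S₁`) and more than `|Z|/2` slots of the family have a non-zero shadow on
> `Z`, the family is DEGENERATE.

This is the permutation-module form of the tree's capacity theorem `card_le_finrank_of_forall_map_slotExt_le`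
(`CMTypeRankEvaluationCriterion`: in an additive family at most `dim V` slots touch a representation `V`), with
`V = Anti(ℚ^Z)` and the evaluation vectors made explicit as signatures — so that the hypothesis is a COUNT.  For CM
fields (file F6 `CommonCMSubfieldCapacity`): more than `[k:ℚ]/2` CM fields that are quadratic over a common totally
complex field `k` never carry a nondegenerate family, whatever the types — e.g. three simple CM fourfolds whose octic
fields contain one quartic CM field.

## References

* [Mai1989] L. Mai, *Lower bounds for the ranks of CM types*, J. Number Theory 32 (1989), §2 Prop. 1 (proof: the rank as
  a sum over irreducible representations).
* [Gordon1999HodgeAVSurvey] B. B. Gordon, *A survey of the Hodge conjecture for abelian varieties*, §3 Theorem (proof),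
  7.5–7.7, 9.4.3.
* [Kubota1965] T. Kubota, *On the field extension by complex multiplication*, Trans. AMS 118 (1965), §2, Lemma 2.

Provenance: Literature home (namespace `Literature.NumberTheory.ComplexMultiplication.Shadow`) of the Summits-side `CorCM/ParallelShadowsCapacity` (cell `pub-hodgecm2`, COR-CM; all its imports are `Literature/`, Mathlib and the already re-homed `ParallelShadowsSlots`), which `Literature/` may not import; theorems only, no named fact, no definition. Nothing here bears on `HC_CM`. Lane `lit-hodgefound` (Layer A3: CM types, their Kubota ranks and Galois combinatorics), seat p20.
-/

set_option autoImplicit false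

noncomputable section

open scoped BigOperators

universe u v w

namespace Literature.NumberTheory.ComplexMultiplication.Shadow

open Literature.NumberTheory.ComplexMultiplication
open scoped Classical

variable {G : Type u} [Group G] {I : Type v} {E : I → Type v} [∀ i, MulAction G (E i)]

/-! ### §1 Shadows are odd; the odd functions on `Z` have dimension at most `|Z|/2` -/

section Odd

variable {X : Type*} [MulAction G X] [Fintype X] {Z : Type w} [MulAction G Z] [Fintype Z]

omit [Fintype Z] in
/-- **Shadows are `ρ`-odd**: `Σ_{π x = ρz} u_1(Φ)(x) = −Σ_{π x = z} u_1(Φ)(x)` (the fibre over `ρz` is `ρ` times the fibre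
over `z`, and `u_1(Φ)(ρx) = −u_1(Φ)(x)`). [cite: Kubota1965, §2 (p. 115)] -/
theorem fibreSum_antiVec_one_rho_smul {ρ : G} {Φ : Set X} (hΦ : IsCMTypeWith ρ Φ) {π : X → Z}
    (hπ : ∀ (g : G) (x : X), π (g • x) = g • π x) (z : Z) :
    ∑ x ∈ Finset.univ.filter (fun x : X => π x = ρ • z), antiVec Φ (1 : G) x =
      -∑ x ∈ Finset.univ.filter (fun x : X => π x = z), antiVec Φ (1 : G) x := by
  have hodd : ∀ x : X, antiVec Φ (1 : G) (ρ • x) = -antiVec Φ (1 : G) x := fun x =>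
    (mem_antiWeights_iff'.1 (antiVec_mem_antiWeights hΦ 1)) x
  rw [← Finset.sum_neg_distrib]
  symm
  refine Finset.sum_nbij' (fun x => ρ • x) (fun y => ρ⁻¹ • y) ?_ ?_ ?_ ?_ ?_
  · intro x hx
    simp only [Finset.mem_filter, Finset.mem_univ, true_and] at hx ⊢
    rw [hπ, hx]
  · intro y hy
    simp only [Finset.mem_filter, Finset.mem_univ, true_and] at hy ⊢
    rw [hπ, hy, inv_smul_smul]
  · intro x _
    exact inv_smul_smul ρ x
  · intro y _
    exact smul_inv_smul ρ y
  · intro x _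
    exact (hodd x).symm

omit [MulAction G X] [Fintype X] in
/-- **The `ρ`-odd functions on `Z` have dimension at most `|Z|/2`** when `Z` carries a CM type `S₁` for `ρ`: an odd
function vanishing on `S₁` vanishes (every point is in `S₁` or `ρ`-conjugate to one), so restriction to `S₁` is
injective on `Anti(Z)`, and `2 |S₁| = |Z|`. [cite: Kubota1965, §2 (p. 115)] -/
theorem finrank_antiWeights_le {ρ : G} {S₁ : Set Z} (hS : IsCMTypeWith ρ S₁) :
    Module.finrank ℚ (antiWeights (E := Z) ρ) ≤ Fintype.card Z / 2 := by
  -- `2 |S₁| = |Z|`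
  have hcard : 2 * (Finset.univ.filter fun z : Z => z ∈ S₁).card = Fintype.card Z := by
    have himage : (Finset.univ.filter fun z : Z => z ∈ S₁).image (fun z => ρ • z) =
        Finset.univ.filter fun z : Z => z ∉ S₁ := by
      ext z
      simp only [Finset.mem_image, Finset.mem_filter, Finset.mem_univ, true_and]
      constructor
      · rintro ⟨y, hy, rfl⟩
        exact (hS.mem_iff y).1 hy
      · intro hz
        exact ⟨ρ • z, (hS.rho_smul_mem_iff z).2 hz, hS.invol z⟩
    have hinj : Set.InjOn (fun z : Z => ρ • z) ↑(Finset.univ.filter fun z : Z => z ∈ S₁) := fun a _ b _ hab => by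
      simpa [hS.invol] using congrArg (fun t => ρ • t) hab
    have h1 := Finset.card_image_of_injOn hinj
    rw [himage] at h1
    have h2 := Finset.card_filter_add_card_filter_not (s := (Finset.univ : Finset Z)) (fun z : Z => z ∈ S₁)
    rw [Finset.card_univ] at h2
    omega
  -- restriction to `S₁` is injective on the odd functions
  let T : Type w := ↥(Finset.univ.filter fun z : Z => z ∈ S₁)
  let R : (Z → ℚ) →ₗ[ℚ] (T → ℚ) := LinearMap.funLeft ℚ ℚ (fun t : T => (t : Z))
  have hinj : ∀ f ∈ antiWeights (E := Z) ρ, R f = 0 → f = 0 := by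
    intro f hf hRf
    have hodd := mem_antiWeights_iff'.1 hf
    have hvan : ∀ z ∈ S₁, f z = 0 := fun z hz => by
      have := congrFun hRf ⟨z, Finset.mem_filter.2 ⟨Finset.mem_univ _, hz⟩⟩
      simpa [R] using this
    funext z
    by_cases hz : z ∈ S₁
    · exact hvan z hz
    · have h1 : f (ρ • z) = 0 := hvan _ ((hS.rho_smul_mem_iff z).2 hz)
      rw [hodd] at h1
      simpa using h1
  have hker : LinearMap.ker (R.domRestrict (antiWeights (E := Z) ρ)) = ⊥ := by
    rw [LinearMap.ker_eq_bot']
    rintro ⟨f, hf⟩ h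
    exact Subtype.ext (hinj f hf h)
  have hle := LinearMap.finrank_le_finrank_of_injective (LinearMap.ker_eq_bot.1 hker)
  rw [Module.finrank_fintype_fun_eq_card, Fintype.card_coe] at hle
  omega

end Odd

/-! ### §2 A non-trivial linear relation among the shadows makes the rank defect positive -/

section Dependent

variable [DecidableEq I] [Fintype I] [∀ i, Fintype (E i)] {Z : Type w} [MulAction G Z]

/-- **Linearly dependent shadows ⟹ the rank is not additive.**  For equivariant `π_i : E_i → Z` and coefficients `λ_i`
with `Σ_{i∈S} λ_i c_i(z) = 0` for all `z` (`c_i(z) = Σ_{π_i x = z} u_1(Φ_i)(x)`) and `λ_{i₀} c_{i₀}(z₀) ≠ 0` for some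
`i₀ ∈ S`: `dim U(Σ) < Σ_i dim U(Φ_i)`.  (The form `w ↦ Σ_{i∈S} λ_i Σ_{π_i x = z₀} w(i,x)` kills every `u_g(Σ)` — value
`Σ_i λ_i c_i(g z₀) = 0` — but not `ext_{i₀} u_1(Φ_{i₀})`.) [cite: Mai1989, §2 Prop. 1 (proof)]
[cite: Gordon1999HodgeAVSurvey, §3 Theorem (proof) and 7.5] -/
theorem finrank_antiSpan_sigmaType_lt_of_dependent (Φ : ∀ i, Set (E i)) (π : ∀ i, E i → Z)
    (hπ : ∀ i (g : G) (x : E i), π i (g • x) = g • π i x) (S : Finset I) (coef : I → ℚ)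
    (hdep : ∀ z : Z, ∑ i ∈ S, coef i * ∑ x ∈ Finset.univ.filter (fun x : E i => π i x = z), antiVec (Φ i) (1 : G) x = 0)
    {i₀ : I} (hi₀ : i₀ ∈ S) {z₀ : Z}
    (hz₀ : coef i₀ * ∑ x ∈ Finset.univ.filter (fun x : E i₀ => π i₀ x = z₀), antiVec (Φ i₀) (1 : G) x ≠ 0) :
    Module.finrank ℚ (antiSpan G (sigmaType Φ)) < ∑ i, Module.finrank ℚ (antiSpan G (Φ i)) := by
  -- the separating linear form
  let L : ∀ i, ((Σ j, E j) → ℚ) →ₗ[ℚ] ℚ := fun i =>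
    ∑ x : E i, (if π i x = z₀ then (1 : ℚ) else 0) • LinearMap.proj (⟨i, x⟩ : Σ j, E j)
  let lam : ((Σ j, E j) → ℚ) →ₗ[ℚ] ℚ := ∑ i ∈ S, coef i • L i
  have hL : ∀ i (w : (Σ j, E j) → ℚ), L i w = ∑ x, (if π i x = z₀ then (1 : ℚ) else 0) * w ⟨i, x⟩ := fun i w => by
    simp only [L, LinearMap.sum_apply, LinearMap.smul_apply, LinearMap.proj_apply, smul_eq_mul]
  have hlam : ∀ w : (Σ j, E j) → ℚ, lam w = ∑ i ∈ S, coef i * ∑ x, (if π i x = z₀ then (1 : ℚ) else 0) * w ⟨i, x⟩ :=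
    fun w => by simp only [lam, LinearMap.sum_apply, LinearMap.smul_apply, hL, smul_eq_mul]
  -- `λ` kills every simultaneous translate, hence `U(Σ)`
  have hker : antiSpan G (sigmaType Φ) ≤ LinearMap.ker lam := by
    refine Submodule.span_le.2 ?_
    rintro _ ⟨g, rfl⟩
    rw [SetLike.mem_coe, LinearMap.mem_ker, hlam]
    simp only [antiVec_sigmaType]
    have hi : ∀ i, ∑ x, (if π i x = z₀ then (1 : ℚ) else 0) * antiVec (Φ i) g x =
        ∑ x ∈ Finset.univ.filter (fun x : E i => π i x = g • z₀), antiVec (Φ i) (1 : G) x := fun i => by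
      rw [sum_mul_antiVec_eq_apply_smul (Φ i) (fun z x => if π i x = z then (1 : ℚ) else 0)
        (fun g' z x => fibreInd_smul (hπ i) g' z x) g z₀, sum_fibreInd_mul_eq]
    simp only [hi]
    exact hdep (g • z₀)
  -- `ext_{i₀} u_1(Φ_{i₀})` lies in `⊕_i ext_i U(Φ_i)` but not in `ker λ`
  set W := LinearMap.range (sigmaLift ∘ₗ LinearMap.pi fun i => (antiSpan G (Φ i)).subtype ∘ₗ LinearMap.proj i)
    with hWdef
  have hvW : slotExt i₀ (antiVec (Φ i₀) (1 : G)) ∈ W := by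
    refine ⟨Pi.single i₀ ⟨antiVec (Φ i₀) (1 : G), Submodule.subset_span ⟨1, rfl⟩⟩, ?_⟩
    funext x
    obtain ⟨j, s⟩ := x
    change ((Pi.single (M := fun i => antiSpan G (Φ i)) i₀
      ⟨antiVec (Φ i₀) (1 : G), Submodule.subset_span ⟨1, rfl⟩⟩ j : antiSpan G (Φ j)) : E j → ℚ) s =
      slotExt i₀ (antiVec (Φ i₀) (1 : G)) ⟨j, s⟩
    by_cases hj : j = i₀
    · subst hj
      rw [Pi.single_eq_same, slotExt_apply_same]
    · rw [Pi.single_eq_of_ne hj, slotExt_apply_of_ne hj]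
      rfl
  have hvl : lam (slotExt i₀ (antiVec (Φ i₀) (1 : G))) ≠ 0 := by
    rw [hlam, Finset.sum_eq_single_of_mem i₀ hi₀ (fun i _ hi => ?_)]
    · simp only [slotExt_apply_same]
      rw [sum_fibreInd_mul_eq]
      exact hz₀
    · simp only [slotExt_apply_of_ne hi, mul_zero, Finset.sum_const_zero]
  -- strictness
  have hlt : antiSpan G (sigmaType Φ) < W := by
    refine lt_of_le_of_ne (antiSpan_sigmaType_le_range Φ) fun heq => hvl ?_
    have hv : slotExt i₀ (antiVec (Φ i₀) (1 : G)) ∈ antiSpan G (sigmaType Φ) := by rw [heq]; exact hvW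
    exact LinearMap.mem_ker.1 (hker hv)
  calc Module.finrank ℚ (antiSpan G (sigmaType Φ))
      < Module.finrank ℚ W := Submodule.finrank_lt_finrank_of_lt hlt
    _ ≤ Module.finrank ℚ (∀ i, antiSpan G (Φ i)) := LinearMap.finrank_range_le _
    _ = ∑ i, Module.finrank ℚ (antiSpan G (Φ i)) := Module.finrank_pi_fintype ℚ

variable [Nonempty I] [∀ i, Nonempty (E i)]

/-- **Linearly dependent shadows ⟹ `rank(Σ) + |I| < Σ_i rank(Φ_i) + 1`.** [cite: Mai1989, §2 Prop. 1 (proof)]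
[cite: Gordon1999HodgeAVSurvey, 7.5] -/
theorem typeRank_sigmaType_add_card_lt_of_dependent {ρ : G} {Φ : ∀ i, Set (E i)} (h : ∀ i, IsCMTypeWith ρ (Φ i))
    (π : ∀ i, E i → Z) (hπ : ∀ i (g : G) (x : E i), π i (g • x) = g • π i x) (S : Finset I) (coef : I → ℚ)
    (hdep : ∀ z : Z, ∑ i ∈ S, coef i * ∑ x ∈ Finset.univ.filter (fun x : E i => π i x = z), antiVec (Φ i) (1 : G) x = 0)
    {i₀ : I} (hi₀ : i₀ ∈ S) {z₀ : Z}
    (hz₀ : coef i₀ * ∑ x ∈ Finset.univ.filter (fun x : E i₀ => π i₀ x = z₀), antiVec (Φ i₀) (1 : G) x ≠ 0) :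
    typeRank G (sigmaType Φ) + Fintype.card I < (∑ i, typeRank G (Φ i)) + 1 := by
  obtain ⟨j₀⟩ := ‹Nonempty I›
  haveI : Nonempty (Σ i, E i) := ⟨⟨j₀, Classical.arbitrary (E j₀)⟩⟩
  rw [(IsCMTypeWith.sigmaType h).typeRank_eq_finrank_antiSpan_add_one,
    Finset.sum_congr rfl fun i _ => (h i).typeRank_eq_finrank_antiSpan_add_one, Finset.sum_add_distrib,
    Finset.sum_const, Finset.card_univ, smul_eq_mul, mul_one]
  have := finrank_antiSpan_sigmaType_lt_of_dependent Φ π hπ S coef hdep hi₀ hz₀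
  omega

end Dependent

/-! ### §3 Capacity: more than `|Z|/2` slots with non-zero shadow are jointly degenerate -/

section Capacity

variable [DecidableEq I] [Fintype I] [∀ i, Fintype (E i)] [Nonempty I] [∀ i, Nonempty (E i)] {Z : Type w}
  [MulAction G Z] [Fintype Z]

/-- **Capacity of a common quotient.**  Let `Z` carry a CM type `S₁` for `ρ`, let `π_i : E_i → Z` be equivariant, and
let `S` be a set of MORE THAN `|Z|/2` slots each of which has a non-zero shadow on `Z`.  Then
`rank(Σ) + |I| < Σ_i rank(Φ_i) + 1`: the shadows are `ρ`-odd, the odd functions have dimension `≤ |Z|/2`, so the shadows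
of the slots of `S` satisfy a non-trivial linear relation. [cite: Mai1989, §2 Prop. 1 (proof)] [cite: Gordon1999HodgeAVSurvey, 7.5–7.7] -/
theorem typeRank_sigmaType_add_card_lt_of_card_lt {ρ : G} {Φ : ∀ i, Set (E i)} (h : ∀ i, IsCMTypeWith ρ (Φ i))
    {S₁ : Set Z} (hS₁ : IsCMTypeWith ρ S₁) (π : ∀ i, E i → Z) (hπ : ∀ i (g : G) (x : E i), π i (g • x) = g • π i x)
    (S : Finset I) (hS : Fintype.card Z / 2 < S.card)
    (hne : ∀ i ∈ S, ∃ z : Z, ∑ x ∈ Finset.univ.filter (fun x : E i => π i x = z), antiVec (Φ i) (1 : G) x ≠ 0) :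
    typeRank G (sigmaType Φ) + Fintype.card I < (∑ i, typeRank G (Φ i)) + 1 := by
  -- the shadows as odd functions on `Z`
  let c : I → Z → ℚ := fun i z => ∑ x ∈ Finset.univ.filter (fun x : E i => π i x = z), antiVec (Φ i) (1 : G) x
  have hc : ∀ i, c i ∈ antiWeights (E := Z) ρ := fun i =>
    mem_antiWeights_iff'.2 fun z => fibreSum_antiVec_one_rho_smul (h i) (hπ i) z
  -- they cannot be linearly independent on `S`
  have hdep : ¬ LinearIndependent ℚ fun i : S => c i := by
    intro hli
    have hli' : LinearIndependent ℚ fun i : S => (⟨c i, hc i⟩ : antiWeights (E := Z) ρ) :=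
      LinearIndependent.of_comp (antiWeights (E := Z) ρ).subtype hli
    have h1 := hli'.fintype_card_le_finrank
    have h2 := finrank_antiWeights_le hS₁
    rw [Fintype.card_coe] at h1
    omega
  rw [Fintype.not_linearIndependent_iff] at hdep
  obtain ⟨g, hg, ⟨i₀, hi₀S⟩, hgi₀⟩ := hdep
  -- extend the coefficients by zero off `S`
  let coef : I → ℚ := fun i => if hi : i ∈ S then g ⟨i, hi⟩ else 0
  have hrel : ∀ z : Z, ∑ i ∈ S, coef i * c i z = 0 := fun z => by
    have h1 : (∑ i : S, g i • c (i : I)) z = 0 := by rw [hg]; rfl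
    rw [Finset.sum_apply] at h1
    rw [← Finset.sum_coe_sort S]
    refine Eq.trans (Finset.sum_congr rfl fun i _ => ?_) h1
    simp only [coef, dif_pos i.2, Pi.smul_apply, smul_eq_mul]
  obtain ⟨z₀, hz₀⟩ := hne i₀ hi₀S
  refine typeRank_sigmaType_add_card_lt_of_dependent h π hπ S coef hrel hi₀S (z₀ := z₀) ?_
  simp only [coef, dif_pos hi₀S]
  exact mul_ne_zero hgi₀ hz₀

/-- **Capacity, degeneracy form**: under the hypotheses of `typeRank_sigmaType_add_card_lt_of_card_lt` the family is
DEGENERATE (`rank(Σ) < |⊔ E_i|/2 + 1`) — e.g. three CM fields quadratic over a common quartic CM field, with types of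
non-zero signature, whatever else is true. [cite: Gordon1999HodgeAVSurvey, 7.5–7.7] -/
theorem typeRank_sigmaType_lt_of_card_lt {ρ : G} {Φ : ∀ i, Set (E i)} (h : ∀ i, IsCMTypeWith ρ (Φ i))
    {S₁ : Set Z} (hS₁ : IsCMTypeWith ρ S₁) (π : ∀ i, E i → Z) (hπ : ∀ i (g : G) (x : E i), π i (g • x) = g • π i x)
    (S : Finset I) (hS : Fintype.card Z / 2 < S.card)
    (hne : ∀ i ∈ S, ∃ z : Z, ∑ x ∈ Finset.univ.filter (fun x : E i => π i x = z), antiVec (Φ i) (1 : G) x ≠ 0) :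
    typeRank G (sigmaType Φ) < Fintype.card (Σ i, E i) / 2 + 1 := by
  have hlt := typeRank_sigmaType_add_card_lt_of_card_lt h hS₁ π hπ S hS hne
  have hle : ∀ i, typeRank G (Φ i) ≤ Fintype.card (E i) / 2 + 1 := fun i => (h i).typeRank_le
  have hsum : ∑ i, typeRank G (Φ i) ≤ ∑ i, (Fintype.card (E i) / 2 + 1) := Finset.sum_le_sum fun i _ => hle i
  rw [Finset.sum_add_distrib, Finset.sum_const, Finset.card_univ, smul_eq_mul, mul_one] at hsum
  rw [card_sigma_div_two h]
  omega

end Capacity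

end Literature.NumberTheory.ComplexMultiplication.Shadow

end
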